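import Summits.SmoothPoincare4.SmoothPoincare4.Theorems.EntropyRungMargerinRailsDefs
import Mathlib.Analysis.Convex.SpecificFunctions.Pow
import Mathlib.Analysis.SpecialFunctions.Pow.Continuity
import Mathlib.Algebra.QuadraticDiscriminant
import HarnessLib

/-!
# Margerin's pinching sets are closed and convex
(helper of stub `stub_pinchingPreserved` of line `margerin-cone-hamilton-rails`, crux
`EntropyRung.ChangGurskyYang`, item stmt-SmoothPoincare4-10834)

Two of the four hypotheses on the pinching sets
`Z = pinchingSet m c K τ = margerinCone c ∩ {R ≥ m} ∩ {|𝒟|² ≤ K R^{2−τ}}` (vocabulary of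
`Theorems/EntropyRungMargerinRailsDefs.lean`) required by Hamilton's maximum principle for the
curvature ODE (`hamilton_maximumPrinciple_curvatureODE`; Hamilton 1986, §5, Def. 5.1: a pinching
set is closed, convex, invariant):

* `convex_pinchingSet` (registered) — the Bianchi locus is linear (`isSymm_combo`), `{R ≥ m}` is a
  half-space, `|𝒟|² = ‖A‖² + 2‖B‖² + ‖C‖² − R²/6` is a positive semidefinite quadratic form
  (`devNormSq_nonneg`: `R² ≤ 6·Σ(diagonal entries)²`) with chord expansion `devNormSq_combo` and
  Cauchy–Schwarz for its polar form (`polar_sq_le`, by the discriminant), so `√|𝒟|²` is convex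
  (`devNormSq_combo_le`); hence the second-order cone `{√|𝒟|² ≤ √c·R}` and the hypograph
  `{√|𝒟|² ≤ √K·R^{1−τ/2}}` of the concave `R ↦ R^{1−τ/2}` on `R ≥ 0` (`Real.concaveOn_rpow`,
  `0 ≤ 1 − τ/2 ≤ 1`, i.e. `0 ≤ τ ≤ 2`; `sq_combo_le_rpow`) are convex;
* `isClosed_pinchingSet` — preimages of closed half-lines under continuous functions of the `27`
  entries (`R ↦ R^{2−τ}` is continuous for `2 − τ ≥ 0`, `Real.continuous_rpow_const`).

Everything is proved; no definition, no named fact.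

References: R. S. Hamilton, J. Differential Geom. 24 (1986) 153–179, §5, Def. 5.1 (p. 163)
[Hamilton1986]; C. Margerin, Comm. Anal. Geom. 6 (1998) 21–65, Part I, p. 25 and Prop. 4 (p. 27)
[Margerin1998].
-/

noncomputable section

-- the registered namespace `Summit.SmoothPoincare4.SmoothPoincare4.Theorems` repeats a component
set_option linter.dupNamespace false

open Set Function
open scoped Matrix BigOperators Topology

namespace Summit.SmoothPoincare4.SmoothPoincare4.Theorems.MargerinRails

open Literature.Geometry.Riemannian
open Literature.Geometry.Riemannian.HamiltonODE hiding HasDerivAt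

/-! ### Linear structure: `R` and `|𝒟|²` under convex combinations -/

/-- `R` is linear: `R(a x + b y) = a R(x) + b R(y)`. [folklore] -/
theorem scal_combo (x y : Blocks) (a b : ℝ) : scal (a • x + b • y) = a * scal x + b * scal y := by
  simp only [scal, Prod.fst_add, Prod.snd_add, Prod.smul_fst, Prod.smul_snd, Matrix.trace_add,
    Matrix.trace_smul, smul_eq_mul]
  ring

/-- **Chord expansion of the deviation**: `|𝒟|²(a x + b y) = a²|𝒟|²(x) + 2ab⟨x, y⟩_𝒟 + b²|𝒟|²(y)`
with the polar form `⟨x, y⟩_𝒟 = pairing x y − R(x)R(y)/6`. [folklore] -/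
theorem devNormSq_combo (x y : Blocks) (a b : ℝ) :
    devNormSq (a • x + b • y) =
      a ^ 2 * devNormSq x + 2 * a * b * (pairing x y - scal x * scal y / 6) +
        b ^ 2 * devNormSq y := by
  obtain ⟨A, B, C⟩ := x
  obtain ⟨A', B', C'⟩ := y
  simp only [devNormSq, rmNormSq, frobSq, pairing, scal, Prod.fst_add, Prod.snd_add,
    Prod.smul_fst, Prod.smul_snd, Matrix.add_apply, Matrix.smul_apply, smul_eq_mul,
    Matrix.trace_fin_three, Fin.sum_univ_three]
  ring

/-- **The deviation is a positive semidefinite quadratic form**: `|𝒟|² ≥ 0`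
(`R² = (Σ of six diagonal entries)² ≤ 6 Σ (diagonal entries)²`). [folklore] -/
theorem devNormSq_nonneg (p : Blocks) : 0 ≤ devNormSq p := by
  obtain ⟨A, B, C⟩ := p
  simp only [devNormSq, rmNormSq, frobSq, scal, Matrix.trace_fin_three, Fin.sum_univ_three]
  linarith [sq_nonneg (A 0 0 - A 1 1), sq_nonneg (A 0 0 - A 2 2), sq_nonneg (A 1 1 - A 2 2),
    sq_nonneg (C 0 0 - C 1 1), sq_nonneg (C 0 0 - C 2 2), sq_nonneg (C 1 1 - C 2 2),
    sq_nonneg (A 0 0 - C 0 0), sq_nonneg (A 0 0 - C 1 1), sq_nonneg (A 0 0 - C 2 2),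
    sq_nonneg (A 1 1 - C 0 0), sq_nonneg (A 1 1 - C 1 1), sq_nonneg (A 1 1 - C 2 2),
    sq_nonneg (A 2 2 - C 0 0), sq_nonneg (A 2 2 - C 1 1), sq_nonneg (A 2 2 - C 2 2),
    sq_nonneg (A 0 1), sq_nonneg (A 0 2), sq_nonneg (A 1 0), sq_nonneg (A 1 2),
    sq_nonneg (A 2 0), sq_nonneg (A 2 1), sq_nonneg (C 0 1), sq_nonneg (C 0 2),
    sq_nonneg (C 1 0), sq_nonneg (C 1 2), sq_nonneg (C 2 0), sq_nonneg (C 2 1),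
    sq_nonneg (B 0 0), sq_nonneg (B 0 1), sq_nonneg (B 0 2), sq_nonneg (B 1 0),
    sq_nonneg (B 1 1), sq_nonneg (B 1 2), sq_nonneg (B 2 0), sq_nonneg (B 2 1),
    sq_nonneg (B 2 2)]

/-- **Cauchy–Schwarz for the polar form of `|𝒟|²`**: `⟨x, y⟩_𝒟² ≤ |𝒟|²(x)|𝒟|²(y)` (the
discriminant of the non-negative quadratic `t ↦ |𝒟|²(x + t y)`). [folklore] -/
theorem polar_sq_le (x y : Blocks) :
    (pairing x y - scal x * scal y / 6) ^ 2 ≤ devNormSq x * devNormSq y := by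
  have h : ∀ t : ℝ, 0 ≤ devNormSq y * (t * t) + 2 * (pairing x y - scal x * scal y / 6) * t +
      devNormSq x := by
    intro t
    have h0 := devNormSq_nonneg ((1 : ℝ) • x + t • y)
    rw [devNormSq_combo] at h0
    nlinarith [h0]
  have hd := discrim_le_zero h
  rw [discrim] at hd
  nlinarith [hd]

/-- **`√|𝒟|²` is convex** (chord form): `|𝒟|²(a x + b y) ≤ (a√|𝒟|²(x) + b√|𝒟|²(y))²` for
`a, b ≥ 0`. [folklore] -/
theorem devNormSq_combo_le (x y : Blocks) {a b : ℝ} (ha : 0 ≤ a) (hb : 0 ≤ b) :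
    devNormSq (a • x + b • y) ≤ (a * √(devNormSq x) + b * √(devNormSq y)) ^ 2 := by
  rw [devNormSq_combo]
  have hP : pairing x y - scal x * scal y / 6 ≤ √(devNormSq x) * √(devNormSq y) := by
    rw [← Real.sqrt_mul (devNormSq_nonneg x)]
    exact Real.le_sqrt_of_sq_le (polar_sq_le x y)
  have e : (a * √(devNormSq x) + b * √(devNormSq y)) ^ 2 = a ^ 2 * devNormSq x +
      2 * a * b * (√(devNormSq x) * √(devNormSq y)) + b ^ 2 * devNormSq y := by
    rw [add_sq, mul_pow, mul_pow, Real.sq_sqrt (devNormSq_nonneg x),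
      Real.sq_sqrt (devNormSq_nonneg y)]
    ring
  rw [e]
  have := mul_le_mul_of_nonneg_left hP (by positivity : (0 : ℝ) ≤ 2 * a * b)
  linarith

/-- **The hypograph chord inequality** behind `{|𝒟|² ≤ K R^{2−τ}}`: for `a, b ≥ 0`, `a + b = 1`,
`K ≥ 0`, `0 ≤ τ ≤ 2`, `Dᵢ ≤ K Rᵢ^{2−τ}` with `Rᵢ ≥ 0`,
`(a√D₁ + b√D₂)² ≤ K (aR₁ + bR₂)^{2−τ}` (`√K R^{1−τ/2}` is concave, `Real.concaveOn_rpow`).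
[folklore] -/
theorem sq_combo_le_rpow {a b K τ D₁ D₂ R₁ R₂ : ℝ} (ha : 0 ≤ a) (hb : 0 ≤ b) (hab : a + b = 1)
    (hK : 0 ≤ K) (hτ0 : 0 ≤ τ) (hτ2 : τ ≤ 2) (hR₁ : 0 ≤ R₁) (hR₂ : 0 ≤ R₂)
    (h₁ : D₁ ≤ K * R₁ ^ (2 - τ)) (h₂ : D₂ ≤ K * R₂ ^ (2 - τ)) :
    (a * √D₁ + b * √D₂) ^ 2 ≤ K * (a * R₁ + b * R₂) ^ (2 - τ) := by
  set β : ℝ := 1 - τ / 2 with hβ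
  have hβ0 : 0 ≤ β := by rw [hβ]; linarith
  have hβ1 : β ≤ 1 := by rw [hβ]; linarith
  have hpow : ∀ R : ℝ, 0 ≤ R → R ^ (2 - τ) = (R ^ β) ^ 2 := fun R hR ↦ by
    rw [← Real.rpow_natCast, ← Real.rpow_mul hR]
    congr 1
    rw [hβ]
    push_cast
    ring
  have hs₁ : √D₁ ≤ √K * R₁ ^ β := by
    rw [Real.sqrt_le_left (mul_nonneg (Real.sqrt_nonneg K) (Real.rpow_nonneg hR₁ β)), mul_pow,
      Real.sq_sqrt hK, ← hpow R₁ hR₁]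
    exact h₁
  have hs₂ : √D₂ ≤ √K * R₂ ^ β := by
    rw [Real.sqrt_le_left (mul_nonneg (Real.sqrt_nonneg K) (Real.rpow_nonneg hR₂ β)), mul_pow,
      Real.sq_sqrt hK, ← hpow R₂ hR₂]
    exact h₂
  have hconc : a * R₁ ^ β + b * R₂ ^ β ≤ (a * R₁ + b * R₂) ^ β := by
    have := (Real.concaveOn_rpow hβ0 hβ1).2 (Set.mem_Ici.2 hR₁) (Set.mem_Ici.2 hR₂) ha hb hab
    simpa only [smul_eq_mul] using this
  have hstep : a * √D₁ + b * √D₂ ≤ √K * (a * R₁ + b * R₂) ^ β :=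
    calc a * √D₁ + b * √D₂ ≤ a * (√K * R₁ ^ β) + b * (√K * R₂ ^ β) :=
          add_le_add (mul_le_mul_of_nonneg_left hs₁ ha) (mul_le_mul_of_nonneg_left hs₂ hb)
      _ = √K * (a * R₁ ^ β + b * R₂ ^ β) := by ring
      _ ≤ √K * (a * R₁ + b * R₂) ^ β := mul_le_mul_of_nonneg_left hconc (Real.sqrt_nonneg K)
  have h0 : 0 ≤ a * √D₁ + b * √D₂ :=
    add_nonneg (mul_nonneg ha (Real.sqrt_nonneg _)) (mul_nonneg hb (Real.sqrt_nonneg _))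
  calc (a * √D₁ + b * √D₂) ^ 2 ≤ (√K * (a * R₁ + b * R₂) ^ β) ^ 2 := pow_le_pow_left₀ h0 hstep 2
    _ = K * (a * R₁ + b * R₂) ^ (2 - τ) := by
        rw [mul_pow, Real.sq_sqrt hK, hpow _ (add_nonneg (mul_nonneg ha hR₁) (mul_nonneg hb hR₂))]

/-- **The pinching sets are convex** for `c, K ≥ 0`, `0 ≤ τ ≤ 2`: the Bianchi locus is linear,
`{R ≥ m}` a half-space, `{√|𝒟|² ≤ √c R}` a second-order cone and `{√|𝒟|² ≤ √K R^{1−τ/2}}` the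
hypograph of a concave function over the convex `√|𝒟|²` (Hamilton 1986, Def. 5.1: pinching sets
are convex). [cite: Hamilton1986, §5, Def. 5.1 (p. 163)] -/
theorem convex_pinchingSet :
    ∀ {m c K τ : ℝ}, 0 ≤ c → 0 ≤ K → 0 ≤ τ → τ ≤ 2 → Convex ℝ (pinchingSet m c K τ) := by
  intro m c K τ hc hK hτ0 hτ2 x hx y hy a b ha hb hab
  obtain ⟨⟨hxA, hxC, hxtr, hxR, hxc⟩, hxm, hxK⟩ := hx
  obtain ⟨⟨hyA, hyC, hytr, hyR, hyc⟩, hym, hyK⟩ := hy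
  have hsymm := isSymm_combo ⟨hxA, hxC⟩ ⟨hyA, hyC⟩ a b
  have hs : scal (a • x + b • y) = a * scal x + b * scal y := scal_combo x y a b
  have htr : (a • x + b • y).1.trace = (a • x + b • y).2.2.trace := by
    simp only [Prod.fst_add, Prod.snd_add, Prod.smul_fst, Prod.smul_snd, Matrix.trace_add,
      Matrix.trace_smul, hxtr, hytr]
  have hR : 0 ≤ a * scal x + b * scal y := add_nonneg (mul_nonneg ha hxR) (mul_nonneg hb hyR)
  have hsq := devNormSq_combo_le x y ha hb
  have hcone : devNormSq (a • x + b • y) ≤ c * (a * scal x + b * scal y) ^ 2 := by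
    have h1 : √(devNormSq x) ≤ √c * scal x := by
      rw [Real.sqrt_le_left (mul_nonneg (Real.sqrt_nonneg c) hxR), mul_pow, Real.sq_sqrt hc]
      exact hxc
    have h2 : √(devNormSq y) ≤ √c * scal y := by
      rw [Real.sqrt_le_left (mul_nonneg (Real.sqrt_nonneg c) hyR), mul_pow, Real.sq_sqrt hc]
      exact hyc
    have h3 : a * √(devNormSq x) + b * √(devNormSq y) ≤ √c * (a * scal x + b * scal y) :=
      calc a * √(devNormSq x) + b * √(devNormSq y) ≤ a * (√c * scal x) + b * (√c * scal y) :=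
            add_le_add (mul_le_mul_of_nonneg_left h1 ha) (mul_le_mul_of_nonneg_left h2 hb)
        _ = √c * (a * scal x + b * scal y) := by ring
    have h0 : 0 ≤ a * √(devNormSq x) + b * √(devNormSq y) :=
      add_nonneg (mul_nonneg ha (Real.sqrt_nonneg _)) (mul_nonneg hb (Real.sqrt_nonneg _))
    calc devNormSq (a • x + b • y) ≤ (a * √(devNormSq x) + b * √(devNormSq y)) ^ 2 := hsq
      _ ≤ (√c * (a * scal x + b * scal y)) ^ 2 := pow_le_pow_left₀ h0 h3 2
      _ = c * (a * scal x + b * scal y) ^ 2 := by rw [mul_pow, Real.sq_sqrt hc]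
  refine ⟨⟨hsymm.1, hsymm.2, htr, ?_, ?_⟩, ?_, ?_⟩
  · show 0 ≤ scal (a • x + b • y)
    rw [hs]
    exact hR
  · show devNormSq (a • x + b • y) ≤ c * scal (a • x + b • y) ^ 2
    rw [hs]
    exact hcone
  · show m ≤ scal (a • x + b • y)
    rw [hs]
    calc m = a * m + b * m := by rw [← add_mul, hab, one_mul]
      _ ≤ a * scal x + b * scal y :=
          add_le_add (mul_le_mul_of_nonneg_left hxm ha) (mul_le_mul_of_nonneg_left hym hb)
  · show devNormSq (a • x + b • y) ≤ K * scal (a • x + b • y) ^ (2 - τ)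
    rw [hs]
    exact hsq.trans (sq_combo_le_rpow ha hb hab hK hτ0 hτ2 hxR hyR hxK hyK)

/-! ### Closedness -/

/-- `R` is continuous on block triples. [folklore] -/
theorem continuous_scal : Continuous scal :=
  continuous_fst.matrix_trace.add continuous_snd.snd.matrix_trace

/-- `‖·‖_F²` is continuous. [folklore] -/
theorem continuous_frobSq : Continuous frobSq := by
  unfold frobSq
  exact continuous_finsetSum _ fun i _ ↦ continuous_finsetSum _ fun j _ ↦
    (continuous_id.matrix_elem i j).pow 2

/-- `|𝒟|²` is continuous. [folklore] -/
theorem continuous_devNormSq : Continuous devNormSq := by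
  unfold devNormSq rmNormSq
  exact (((continuous_frobSq.comp continuous_fst).add
    (continuous_const.mul (continuous_frobSq.comp continuous_snd.fst))).add
      (continuous_frobSq.comp continuous_snd.snd)).sub ((continuous_scal.pow 2).div_const 6)

/-- **The pinching sets are closed**: Margerin's cone is cut out by closed linear conditions
(symmetry, `tr A = tr C`), `R ≥ 0` and `|𝒟|² ≤ c R²` with `R`, `|𝒟|²` continuous; `{R ≥ m}` and
`{|𝒟|² ≤ K R^{2−τ}}` are closed as well (`R ↦ R^{2−τ}` is continuous for `τ ≤ 2`). [folklore] -/
theorem isClosed_pinchingSet : ∀ (m c K : ℝ) {τ : ℝ}, τ ≤ 2 → IsClosed (pinchingSet m c K τ) := by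
  intro _ c _ τ hτ2
  have hcone : IsClosed (margerinCone c) :=
    (isClosed_eq continuous_fst.matrix_transpose continuous_fst).inter <|
      (isClosed_eq continuous_snd.snd.matrix_transpose continuous_snd.snd).inter <|
        (isClosed_eq continuous_fst.matrix_trace continuous_snd.snd.matrix_trace).inter <|
          (isClosed_le continuous_const continuous_scal).inter
            (isClosed_le continuous_devNormSq (continuous_const.mul (continuous_scal.pow 2)))
  exact hcone.inter <| (isClosed_le continuous_const continuous_scal).inter <|
    isClosed_le continuous_devNormSq
      (continuous_const.mul ((Real.continuous_rpow_const (by linarith)).comp continuous_scal))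

end Summit.SmoothPoincare4.SmoothPoincare4.Theorems.MargerinRails

end
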